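import Summits.MatrixMultiplication.MatrixMultiplication.Theorems.ObstructionDescentUniversalOccurrenceTwoRectangleQuadPairAlphabet

set_option linter.dupNamespace false
set_option autoImplicit false

/-!
# Universal occurrence — two rectangles and TWO COLUMN PAIRS, part F: the value of a valid term for `(2N-8,4,2,2)` (decomp-mm · lens 3 · gen 43)

Route `route-MatrixMultiplication-ObstructionDescent` (sub-problem `MatrixMultiplication`, `ω(ℂ) = 2`); SUPPORT for the crux
`NoOccurrenceObstruction` (`P_O`, item `stmt-MatrixMultiplication-29040`) through the universal-occurrence programme (NODE-g29…g43
of the decomp-mm cell, lens 3).  Nothing here proves `ω = 2` or closes an item; no `def`, no `sorry`, standard axioms.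

**This file: the heart of the certificate of part G.**  Design: `T` the pair tableau of `(2N-8,4,2,2)` (part D); colouring
`g = (0,1,2,3,0,1,0,0,…)` on the slots; a block structure `e` whose core columns read `[(0,s₀),(1,s₀),(0,s₁),(1,s₁)] ‖
[(1,s₂),(0,s₂),(1,s₃),(0,s₃)]`, `[(0,s₄),(1,s₄)] ‖ [(1,s₅),(0,s₅)]`, arm `(q mod 2, q div 2)` (`q ≥ 12`) — encoded by the
hypothesis `hpos`; twist `H = {s₁, s₃}`.  `quadPair_value_eq_one`: for a valid `σ` (`σ₀⁻¹σ₁` permutes `H`) with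
`e_T(g ∘ w_σ) ≠ 0`, the support of `e_T` (part D), validity at `s₁, s₃`, the colour sums `7` and the unique sources of the colours
`2, 3` put the core letters into the local alphabet of part E; twins evaluate to `1` (part D) and anti-twins are the even column
swap `(4 5)(10 11)` of a twin word.  Hence every term of the floor-law sum is `0` or `+1`.

[cite: BurgisserIkenmeyer2011, §3.4 (Prop. 3.4), Thm. 4.4] [cite: BurgisserIkenmeyer2017, §5, Thm. 5.9 (proof of (2)), eq. (3.4)] [cite: Landsberg2017, §9.1.1]
-/

noncomputable section

open scoped BigOperators

namespace Summit.MatrixMultiplication.MatrixMultiplication.Theorems.ObstructionCalculus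

open Literature.Computability.AlgebraicComplexity
open Literature.NumberTheory.DiophantineGeometry

set_option maxHeartbeats 400000 in
/-- **A valid term of the `(2N-8,4,2,2)` design has `e_T(g ∘ w_σ) ∈ {0, 1}`.** [cite: BurgisserIkenmeyer2011, Thm. 4.4]
[cite: BurgisserIkenmeyer2017, Thm. 5.9 (proof of (2))] -/
theorem quadPair_value_eq_one {N : ℕ} (hN : 6 ≤ N) {Y : YoungDiagram}
    (hNY : ∀ x ∈ Y.cells, x.1 < N) (T : StdFilling (N * 2) Y)
    (hT : ∀ p : Fin (N * 2), T.1 p = (if (p : ℕ) < 4 then ((p : ℕ), 0) else if (p : ℕ) < 8 then ((p : ℕ) - 4, 1)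
      else if (p : ℕ) < 10 then ((p : ℕ) - 8, 2) else if (p : ℕ) < 12 then ((p : ℕ) - 10, 3) else (0, (p : ℕ) - 8)))
    (e : Fin (N * 2) ≃ Fin 2 × Fin N) (g : Fin N → Fin N)
    (hgv : ∀ i : Fin N, ((g i : Fin N) : ℕ) = if (i : ℕ) ≤ 3 then (i : ℕ) else if (i : ℕ) = 5 then 1 else 0)
    (hpos : ∀ (σ : Fin 2 → Equiv.Perm (Fin N)) (n : ℕ) (hn : n < N * 2) (a : Fin 2) (s : Fin N),
      (if n = 4 then 5 else if n = 5 then 4 else if n = 6 then 7 else if n = 7 then 6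
        else if n = 10 then 11 else if n = 11 then 10 else n) % 2 = (a : ℕ) →
      (if n = 4 then 5 else if n = 5 then 4 else if n = 6 then 7 else if n = 7 then 6
        else if n = 10 then 11 else if n = 11 then 10 else n) / 2 = (s : ℕ) →
      (g ∘ fun q => σ (e q).1 (e q).2) ⟨n, hn⟩ = g (σ a s))
    (H : Finset (Fin N)) (hHv : ∀ s : Fin N, s ∈ H ↔ ((s : ℕ) = 1 ∨ (s : ℕ) = 3))
    (σ : Fin 2 → Equiv.Perm (Fin N)) (hval : ∀ s, (σ 0)⁻¹ (σ 1 s) ∈ H ↔ s ∈ H)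
    (hz : T.polytabloid ℂ hNY (g ∘ fun q => σ (e q).1 (e q).2) ≠ 0) :
    T.polytabloid ℂ hNY (g ∘ fun q => σ (e q).1 (e q).2) = 1 := by
  classical
  have hcolT : ∀ q : Fin (N * 2), (T.1 q).2 =
      if (q : ℕ) < 4 then 0 else if (q : ℕ) < 8 then 1
      else if (q : ℕ) < 10 then 2 else if (q : ℕ) < 12 then 3 else (q : ℕ) - 8 := fun q => by
    rw [hT]; split_ifs <;> rfl
  obtain ⟨s0, hs0⟩ : ∃ s : Fin N, (s : ℕ) = 0 := ⟨⟨0, by omega⟩, rfl⟩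
  obtain ⟨s1, hs1⟩ : ∃ s : Fin N, (s : ℕ) = 1 := ⟨⟨1, by omega⟩, rfl⟩
  obtain ⟨s2, hs2⟩ : ∃ s : Fin N, (s : ℕ) = 2 := ⟨⟨2, by omega⟩, rfl⟩
  obtain ⟨s3, hs3⟩ : ∃ s : Fin N, (s : ℕ) = 3 := ⟨⟨3, by omega⟩, rfl⟩
  obtain ⟨s4, hs4⟩ : ∃ s : Fin N, (s : ℕ) = 4 := ⟨⟨4, by omega⟩, rfl⟩
  obtain ⟨s5, hs5⟩ : ∃ s : Fin N, (s : ℕ) = 5 := ⟨⟨5, by omega⟩, rfl⟩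
  obtain ⟨p4, hp4⟩ : ∃ p : Fin (N * 2), (p : ℕ) = 4 := ⟨⟨4, by omega⟩, rfl⟩
  obtain ⟨p5, hp5⟩ : ∃ p : Fin (N * 2), (p : ℕ) = 5 := ⟨⟨5, by omega⟩, rfl⟩
  obtain ⟨p10, hp10⟩ : ∃ p : Fin (N * 2), (p : ℕ) = 10 := ⟨⟨10, by omega⟩, rfl⟩
  obtain ⟨p11, hp11⟩ : ∃ p : Fin (N * 2), (p : ℕ) = 11 := ⟨⟨11, by omega⟩, rfl⟩
  have hg2 : ∀ i : Fin N, ((g i : Fin N) : ℕ) = 2 → i = s2 := by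
    intro i hi; have h := hgv i; rw [hi] at h; apply Fin.ext; split_ifs at h <;> omega
  have hg3 : ∀ i : Fin N, ((g i : Fin N) : ℕ) = 3 → i = s3 := by
    intro i hi; have h := hgv i; rw [hi] at h; apply Fin.ext; split_ifs at h <;> omega
  have hgsum : ∑ i : Fin N, ((g i : Fin N) : ℕ) = 7 := by
    rw [sum_core6_eq (fun i => ((g i : Fin N) : ℕ)) s0 s1 s2 s3 s4 s5 hs0 hs1 hs2 hs3 hs4 hs5
      (fun s hs => by rw [hgv]; split_ifs <;> omega)]
    simp only [hgv, hs0, hs1, hs2, hs3, hs4, hs5]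
    norm_num
  obtain ⟨harm, hlt4, hlt2, hinj⟩ := quadPairTableau_support hNY T hT hz
  have hi0 : ∀ x, σ 0 ((σ 0)⁻¹ x) = x := fun x => (σ 0).apply_symm_apply x
  have u0 := hpos σ 0 (by omega) 0 s0 (by norm_num) (by norm_num [hs0])
  have u1 := hpos σ 1 (by omega) 1 s0 (by norm_num) (by norm_num [hs0])
  have u2 := hpos σ 2 (by omega) 0 s1 (by norm_num) (by norm_num [hs1])
  have u3 := hpos σ 3 (by omega) 1 s1 (by norm_num) (by norm_num [hs1])
  have u4 := hpos σ 4 (by omega) 1 s2 (by norm_num) (by norm_num [hs2])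
  have u5 := hpos σ 5 (by omega) 0 s2 (by norm_num) (by norm_num [hs2])
  have u6 := hpos σ 6 (by omega) 1 s3 (by norm_num) (by norm_num [hs3])
  have u7 := hpos σ 7 (by omega) 0 s3 (by norm_num) (by norm_num [hs3])
  have u8 := hpos σ 8 (by omega) 0 s4 (by norm_num) (by norm_num [hs4])
  have u9 := hpos σ 9 (by omega) 1 s4 (by norm_num) (by norm_num [hs4])
  have u10 := hpos σ 10 (by omega) 1 s5 (by norm_num) (by norm_num [hs5])
  have u11 := hpos σ 11 (by omega) 0 s5 (by norm_num) (by norm_num [hs5])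
  have harm0 : ∀ s : Fin N, 6 ≤ (s : ℕ) → ((g (σ 0 s) : Fin N) : ℕ) = 0 := by
    intro s hs
    have h := hpos σ (2 * s) (by omega) 0 s (by split_ifs <;> omega) (by split_ifs <;> omega)
    rw [← h]; exact harm _ (by simp; omega)
  have harm1 : ∀ s : Fin N, 6 ≤ (s : ℕ) → ((g (σ 1 s) : Fin N) : ℕ) = 0 := by
    intro s hs
    have h := hpos σ (2 * s + 1) (by omega) 1 s (by split_ifs <;> omega) (by split_ifs <;> omega)
    rw [← h]; exact harm _ (by simp; omega)
  -- validity at the twisted slots: `(B₁,B₃) = (A₁,A₃)` or `(A₃,A₁)`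
  have hvH : (((g (σ 1 s1) : Fin N) : ℕ) = ((g (σ 0 s1) : Fin N) : ℕ) ∧
        ((g (σ 1 s3) : Fin N) : ℕ) = ((g (σ 0 s3) : Fin N) : ℕ)) ∨
      (((g (σ 1 s1) : Fin N) : ℕ) = ((g (σ 0 s3) : Fin N) : ℕ) ∧
        ((g (σ 1 s3) : Fin N) : ℕ) = ((g (σ 0 s1) : Fin N) : ℕ)) := by
    obtain ⟨t1, ht1⟩ : ∃ t, σ 0 t = σ 1 s1 := ⟨_, hi0 _⟩
    obtain ⟨t3, ht3⟩ : ∃ t, σ 0 t = σ 1 s3 := ⟨_, hi0 _⟩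
    have k1 : (σ 0)⁻¹ (σ 1 s1) = t1 := (σ 0).injective (by rw [hi0, ht1])
    have k3 : (σ 0)⁻¹ (σ 1 s3) = t3 := (σ 0).injective (by rw [hi0, ht3])
    have m1 : (t1 : ℕ) = 1 ∨ (t1 : ℕ) = 3 :=
      (hHv t1).1 (by rw [← k1]; exact (hval s1).2 ((hHv s1).2 (Or.inl hs1)))
    have m3 : (t3 : ℕ) = 1 ∨ (t3 : ℕ) = 3 :=
      (hHv t3).1 (by rw [← k3]; exact (hval s3).2 ((hHv s3).2 (Or.inr hs3)))
    have hne : (t1 : ℕ) ≠ (t3 : ℕ) := fun h => by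
      have h' : σ 1 s1 = σ 1 s3 := by rw [← ht1, ← ht3, show t1 = t3 from Fin.ext h]
      have := congrArg Fin.val ((σ 1).injective h')
      rw [hs1, hs3] at this; omega
    rw [← ht1, ← ht3]
    rcases m1 with h1 | h1 <;> rcases m3 with h3 | h3
    · exact absurd (h1.trans h3.symm) hne
    · left; rw [show t1 = s1 from Fin.ext (h1.trans hs1.symm), show t3 = s3 from Fin.ext (h3.trans hs3.symm)]
      exact ⟨rfl, rfl⟩
    · right; rw [show t1 = s3 from Fin.ext (h1.trans hs3.symm), show t3 = s1 from Fin.ext (h3.trans hs1.symm)]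
      exact ⟨rfl, rfl⟩
    · exact absurd (h1.trans h3.symm) hne
  have hsA : ((g (σ 0 s0) : Fin N) : ℕ) + ((g (σ 0 s1) : Fin N) : ℕ) + ((g (σ 0 s2) : Fin N) : ℕ) +
      ((g (σ 0 s3) : Fin N) : ℕ) + ((g (σ 0 s4) : Fin N) : ℕ) + ((g (σ 0 s5) : Fin N) : ℕ) = 7 := by
    rw [← sum_core6_eq (fun s => ((g (σ 0 s) : Fin N) : ℕ)) s0 s1 s2 s3 s4 s5 hs0 hs1 hs2 hs3 hs4 hs5 harm0,
      Equiv.sum_comp (σ 0) (fun x => ((g x : Fin N) : ℕ)), hgsum]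
  have hsB : ((g (σ 1 s0) : Fin N) : ℕ) + ((g (σ 1 s1) : Fin N) : ℕ) + ((g (σ 1 s2) : Fin N) : ℕ) +
      ((g (σ 1 s3) : Fin N) : ℕ) + ((g (σ 1 s4) : Fin N) : ℕ) + ((g (σ 1 s5) : Fin N) : ℕ) = 7 := by
    rw [← sum_core6_eq (fun s => ((g (σ 1 s) : Fin N) : ℕ)) s0 s1 s2 s3 s4 s5 hs0 hs1 hs2 hs3 hs4 hs5 harm1,
      Equiv.sum_comp (σ 1) (fun x => ((g x : Fin N) : ℕ)), hgsum]
  -- colours `2`, `3` have a unique source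
  have hx : ∀ (a : Fin 2) (s s' : Fin N) (c : ℕ), (s : ℕ) ≠ (s' : ℕ) → (c = 2 ∨ c = 3) →
      ((g (σ a s) : Fin N) : ℕ) = c → ((g (σ a s') : Fin N) : ℕ) = c → False := by
    intro a s s' c hne hc h1 h2
    have key : σ a s = σ a s' := by
      rcases hc with rfl | rfl
      · exact (hg2 _ h1).trans (hg2 _ h2).symm
      · exact (hg3 _ h1).trans (hg3 _ h2).symm
    exact hne (congrArg Fin.val ((σ a).injective key))
  -- letters and columns
  have bA0 : ((g (σ 0 s0) : Fin N) : ℕ) < 4 := by rw [← u0]; exact hlt4 _ (by norm_num)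
  have bB0 : ((g (σ 1 s0) : Fin N) : ℕ) < 4 := by rw [← u1]; exact hlt4 _ (by norm_num)
  have bA1 : ((g (σ 0 s1) : Fin N) : ℕ) < 4 := by rw [← u2]; exact hlt4 _ (by norm_num)
  have bB1 : ((g (σ 1 s1) : Fin N) : ℕ) < 4 := by rw [← u3]; exact hlt4 _ (by norm_num)
  have bB2 : ((g (σ 1 s2) : Fin N) : ℕ) < 4 := by rw [← u4]; exact hlt4 _ (by norm_num)
  have bA2 : ((g (σ 0 s2) : Fin N) : ℕ) < 4 := by rw [← u5]; exact hlt4 _ (by norm_num)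
  have bA4 : ((g (σ 0 s4) : Fin N) : ℕ) < 2 := by rw [← u8]; exact hlt2 _ (by norm_num) (by norm_num)
  have bB4 : ((g (σ 1 s4) : Fin N) : ℕ) < 2 := by rw [← u9]; exact hlt2 _ (by norm_num) (by norm_num)
  have bB5 : ((g (σ 1 s5) : Fin N) : ℕ) < 2 := by rw [← u10]; exact hlt2 _ (by norm_num) (by norm_num)
  have bA5 : ((g (σ 0 s5) : Fin N) : ℕ) < 2 := by rw [← u11]; exact hlt2 _ (by norm_num) (by norm_num)
  have cne : ∀ (i j : ℕ) (hi : i < N * 2) (hj : j < N * 2), i ≠ j → (T.1 ⟨i, hi⟩).2 = (T.1 ⟨j, hj⟩).2 →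
      ∀ x y : Fin N, (g ∘ fun q => σ (e q).1 (e q).2) ⟨i, hi⟩ = x → (g ∘ fun q => σ (e q).1 (e q).2) ⟨j, hj⟩ = y →
      ((x : Fin N) : ℕ) ≠ ((y : Fin N) : ℕ) := by
    intro i j hi hj hij hc x y hx hy hxy
    have := hinj ⟨i, hi⟩ ⟨j, hj⟩ hc (by rw [hx, hy]; exact Fin.ext hxy)
    simp only [Fin.mk.injEq] at this
    exact hij this
  have c01 := cne 0 1 (by omega) (by omega) (by norm_num) (by rw [hcolT, hcolT]; norm_num) _ _ u0 u1
  have c02 := cne 0 2 (by omega) (by omega) (by norm_num) (by rw [hcolT, hcolT]; norm_num) _ _ u0 u2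
  have c03 := cne 0 3 (by omega) (by omega) (by norm_num) (by rw [hcolT, hcolT]; norm_num) _ _ u0 u3
  have c12 := cne 1 2 (by omega) (by omega) (by norm_num) (by rw [hcolT, hcolT]; norm_num) _ _ u1 u2
  have c13 := cne 1 3 (by omega) (by omega) (by norm_num) (by rw [hcolT, hcolT]; norm_num) _ _ u1 u3
  have c23 := cne 2 3 (by omega) (by omega) (by norm_num) (by rw [hcolT, hcolT]; norm_num) _ _ u2 u3
  have c45 := cne 4 5 (by omega) (by omega) (by norm_num) (by rw [hcolT, hcolT]; norm_num) _ _ u4 u5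
  have c46 := cne 4 6 (by omega) (by omega) (by norm_num) (by rw [hcolT, hcolT]; norm_num) _ _ u4 u6
  have c47 := cne 4 7 (by omega) (by omega) (by norm_num) (by rw [hcolT, hcolT]; norm_num) _ _ u4 u7
  have c56 := cne 5 6 (by omega) (by omega) (by norm_num) (by rw [hcolT, hcolT]; norm_num) _ _ u5 u6
  have c57 := cne 5 7 (by omega) (by omega) (by norm_num) (by rw [hcolT, hcolT]; norm_num) _ _ u5 u7
  have c89 := cne 8 9 (by omega) (by omega) (by norm_num) (by rw [hcolT, hcolT]; norm_num) _ _ u8 u9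
  have cXE := cne 10 11 (by omega) (by omega) (by norm_num) (by rw [hcolT, hcolT]; norm_num) _ _ u10 u11
  have halt := quadPairs_local_configurations _ _ _ _ _ _ _ _ _ _ _ _ bA0 bB0 bA1 bB1 bB2 bA2
    c01 c02 c03 c12 c13 c23 c45 c46 c47 c56 c57 (two_letters_sum bA4 bB4 c89) (two_letters_sum bB5 bA5 cXE)
    hvH hsA hsB (hx 0 s0 s2 2 (by omega) (Or.inl rfl)) (hx 0 s0 s2 3 (by omega) (Or.inr rfl))
    (hx 1 s0 s2 2 (by omega) (Or.inl rfl)) (hx 1 s0 s2 3 (by omega) (Or.inr rfl))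
  clear c01 c02 c03 c12 c13 c23 c45 c46 c47 c56 c57 c89 cXE hx hsA hsB bA0 bB0 bA1 bB1 bB2 bA2 bA4 bB4 bB5 bA5 cne
  have hlt0 : ∀ p : Fin (N * 2), (p : ℕ) < 4 → (((g ∘ fun q => σ (e q).1 (e q).2) p : Fin N) : ℕ) < 4 :=
    fun p hp => hlt4 p (by omega)
  have hinj0 : ∀ p q : Fin (N * 2), (p : ℕ) < 4 → (q : ℕ) < 4 →
      (g ∘ fun q => σ (e q).1 (e q).2) p = (g ∘ fun q => σ (e q).1 (e q).2) q → p = q :=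
    fun p q hp hq hpq => hinj p q (by rw [hcolT, hcolT, if_pos hp, if_pos hq]) hpq
  have hlt2' : ∀ p : Fin (N * 2), 8 ≤ (p : ℕ) → (p : ℕ) < 10 →
      (((g ∘ fun q => σ (e q).1 (e q).2) p : Fin N) : ℕ) < 2 := fun p hp hp' => hlt2 p hp (by omega)
  have hinj2 : ∀ p q : Fin (N * 2), 8 ≤ (p : ℕ) → (p : ℕ) < 10 → 8 ≤ (q : ℕ) → (q : ℕ) < 10 →
      (g ∘ fun q => σ (e q).1 (e q).2) p = (g ∘ fun q => σ (e q).1 (e q).2) q → p = q :=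
    fun p q hp hp' hq hq' hpq => hinj p q (by
      rw [hcolT, hcolT, if_neg (by omega), if_neg (by omega), if_pos hp', if_neg (by omega), if_neg (by omega),
        if_pos hq']) hpq
  rcases halt with ⟨t4, t5, t6, t7, t10, t11⟩ | ⟨a4, a5, a6, a7, a10, a11⟩
  · -- twins
    apply quadPairTableau_twin_eq_one hNY T hT (by omega) harm hlt0 hinj0 hlt2' hinj2
    · intro p hp
      obtain ⟨n, hn⟩ := p
      dsimp only at hp ⊢
      rcases (show n = 0 ∨ n = 1 ∨ n = 2 ∨ n = 3 by omega) with rfl | rfl | rfl | rfl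
      · rw [u0]; exact u4.trans (Fin.ext t4)
      · rw [u1]; exact u5.trans (Fin.ext t5)
      · rw [u2]; exact u6.trans (Fin.ext t6)
      · rw [u3]; exact u7.trans (Fin.ext t7)
    · intro p hp hp'
      obtain ⟨n, hn⟩ := p
      dsimp only at hp hp' ⊢
      rcases (show n = 8 ∨ n = 9 by omega) with rfl | rfl
      · rw [u8]; exact u10.trans (Fin.ext t10)
      · rw [u9]; exact u11.trans (Fin.ext t11)
  · -- anti-twins: an even column swap of a twin word
    rw [← quadPairTableau_evenSwap hNY T hT p4 p5 p10 p11 hp4 hp5 hp10 hp11]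
    set v := (g ∘ fun q => σ (e q).1 (e q).2) with hv
    set q : Equiv.Perm (Fin (N * 2)) := Equiv.swap p4 p5 * Equiv.swap p10 p11 with hq
    have hqv : ∀ x : Fin (N * 2), ((q x : Fin (N * 2)) : ℕ) =
        if (x : ℕ) = 4 then 5 else if (x : ℕ) = 5 then 4 else if (x : ℕ) = 10 then 11 else if (x : ℕ) = 11 then 10
        else (x : ℕ) := by
      intro x
      rw [hq, Equiv.Perm.mul_apply, Equiv.swap_apply_def, Equiv.swap_apply_def]
      simp only [Fin.ext_iff, hp4, hp5, hp10, hp11]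
      split_ifs <;> omega
    have hqfix : ∀ x : Fin (N * 2), (x : ℕ) ≠ 4 → (x : ℕ) ≠ 5 → (x : ℕ) ≠ 10 → (x : ℕ) ≠ 11 → q x = x := by
      intro x h4 h5 h10 h11; apply Fin.ext; rw [hqv]; simp [h4, h5, h10, h11]
    have hq4 : q ⟨4, by omega⟩ = ⟨5, by omega⟩ := Fin.ext (by rw [hqv]; simp)
    have hq5 : q ⟨5, by omega⟩ = ⟨4, by omega⟩ := Fin.ext (by rw [hqv]; simp)
    have hq10 : q ⟨10, by omega⟩ = ⟨11, by omega⟩ := Fin.ext (by rw [hqv]; simp)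
    have hq11 : q ⟨11, by omega⟩ = ⟨10, by omega⟩ := Fin.ext (by rw [hqv]; simp)
    apply quadPairTableau_twin_eq_one hNY T hT (by omega)
    · intro p hp
      show (((v (q p)) : Fin N) : ℕ) = 0
      rw [hqfix p (by omega) (by omega) (by omega) (by omega)]; exact harm p hp
    · intro p hp
      show (((v (q p)) : Fin N) : ℕ) < 4
      rw [hqfix p (by omega) (by omega) (by omega) (by omega)]; exact hlt0 p hp
    · intro p p' hp hp' hpp
      have h : v (q p) = v (q p') := hpp
      rw [hqfix p (by omega) (by omega) (by omega) (by omega),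
        hqfix p' (by omega) (by omega) (by omega) (by omega)] at h
      exact hinj0 p p' hp hp' h
    · intro p hp hp'
      show (((v (q p)) : Fin N) : ℕ) < 2
      rw [hqfix p (by omega) (by omega) (by omega) (by omega)]; exact hlt2' p hp hp'
    · intro p p' hp₁ hp₂ hp'₁ hp'₂ hpp
      have h : v (q p) = v (q p') := hpp
      rw [hqfix p (by omega) (by omega) (by omega) (by omega),
        hqfix p' (by omega) (by omega) (by omega) (by omega)] at h
      exact hinj2 p p' hp₁ hp₂ hp'₁ hp'₂ h
    · intro p hp
      show v (q _) = v (q p)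
      rw [hqfix p (by omega) (by omega) (by omega) (by omega)]
      obtain ⟨n, hn⟩ := p
      dsimp only at hp ⊢
      rcases (show n = 0 ∨ n = 1 ∨ n = 2 ∨ n = 3 by omega) with rfl | rfl | rfl | rfl
      · show v (q ⟨4, _⟩) = v ⟨0, _⟩
        rw [hq4, u5, u0]; exact Fin.ext a5
      · show v (q ⟨5, _⟩) = v ⟨1, _⟩
        rw [hq5, u4, u1]; exact Fin.ext a4
      · show v (q ⟨6, _⟩) = v ⟨2, _⟩
        rw [hqfix _ (by norm_num) (by norm_num) (by norm_num) (by norm_num), u6, u2]; exact Fin.ext a6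
      · show v (q ⟨7, _⟩) = v ⟨3, _⟩
        rw [hqfix _ (by norm_num) (by norm_num) (by norm_num) (by norm_num), u7, u3]; exact Fin.ext a7
    · intro p hp hp'
      show v (q _) = v (q p)
      rw [hqfix p (by omega) (by omega) (by omega) (by omega)]
      obtain ⟨n, hn⟩ := p
      dsimp only at hp hp' ⊢
      rcases (show n = 8 ∨ n = 9 by omega) with rfl | rfl
      · show v (q ⟨10, _⟩) = v ⟨8, _⟩
        rw [hq10, u11, u8]; exact Fin.ext a11
      · show v (q ⟨11, _⟩) = v ⟨9, _⟩
        rw [hq11, u10, u9]; exact Fin.ext a10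

end Summit.MatrixMultiplication.MatrixMultiplication.Theorems.ObstructionCalculus
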